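import Literature.AnabelianGeometry.AbsoluteAnabelian.MonoidKummerModelNaturality
import Literature.AnabelianGeometry.AbsoluteAnabelian.MonoidKummerLimitGroup

/-!
# [AbsTopIII] Prop 3.2 (ii): naturality of the COLIMIT Kummer map `M_TM → lim→_J H¹(J, μ_Ẑ(M_TM))`

S. Mochizuki, *Topics in absolute anabelian geometry III*, §3, Prop. 3.2 (ii) p. 71 (bib key
`MochizukiAbsTopIII2015`; kurims pages, lit key `paper:url-5493eb38cbb7`): "… we obtain a functorial
algorithm for constructing … the Kummer maps `M^H_TM → H¹(H, μ_Ẑ(M_TM))`, `M_TM → lim→_J H¹(J, μ_Ẑ(M_TM))`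
— where … `J` ranges over the open subgroups of `Π`".

The level-wise naturality along an equivariant pair `(φ_Π, φ_M)` between model pairs is
`ModelMLFGaloisData.kummer_natural` (`MonoidKummerModelNaturality.lean`, seat abc-iut-L4-t2): the cospan
`H¹(H₁, Λ₁) —push→ H¹(H₁, res_φ Λ₂) ←pull— H¹(H₂, Λ₂)` of `EtaleTheta.EquivariantMorphism`.  This file passes
to the COLIMIT over open subgroups ("colimit packaging"): with the group-structured direct limits
`lim→_J H¹(J, ·)` of `MonoidKummerLimitGroup.lean` (`ContCohomologyData.H1LimGrp`, `MonoidKummerTheory.kummerGrp`),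

* `EquivariantMorphism.resRepTop / resTop / pullTop / pushTop` (EtaleTheta, generic): the restriction maps of
  the system `J ↦ H¹(J, res_φ Λ(A₂))` on the source group, the pull-back `H¹(J₂, Λ(A₂)) → H¹(φ⁻¹J₂, res Λ(A₂))`
  and the push-forward `H¹(J₁, Λ(A₁)) → H¹(J₁, res Λ(A₂))`, all Mathlib `groupCohomology.map`, with their
  compatibilities with restriction and the level naturality `resTop_pullTop_kummerClass`;
* `resCohomology c hc : ContCohomologyData Π₁` — the comparison system (`H²`-slot: the placeholder `Ẑ`, as in
  the model), and the two colimit maps **`pullLim`** `: lim→ H¹(J₂, Λ₂) →+ lim→ H¹(J₁, res Λ₂)` (index change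
  `J₂ ↦ φ⁻¹J₂`, `φ` continuous) and **`pushLim`** (coefficient change), via `AddCommGroup.DirectLimit.lift`;
* **`pullLim_kummerClass`** — for `a ∈ (k̄₁ˣ)^{J₁}`, `b ∈ (k̄₂ˣ)^{J₂}` with `ψ(a) = b`:
  `pullLim [κ_{J₂}(b)] = pushLim [κ_{J₁}(a)]` (generic: serves the `TM` theory here and the `TLG`/`TCG` unit
  Kummer theories of `UnitKummerModel.lean` alike, all built on `ModelMLFGaloisData.kummerCohomology`);
* **`ModelMLFGaloisData.kummerGrp_natural`** — Prop. 3.2 (ii), colimit form, at the MODEL `TM`-pairs: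
  `pullLim (κ^lim₂(φ_M m)) = pushLim (κ^lim₁(m))` for every `m ∈ 𝒪_k̄₁^⊳`, along any equivariant `(φ_Π, φ_M)`
  with `φ_Π` continuous — in particular along every morphism (`GaloisMonoidPair.Hom.kummerGrp_natural`) and
  every isomorphism (`GaloisMonoidPair.Iso.kummerGrp_natural`) of Def. 3.1 (ii).

Universe `0` throughout (Mathlib `groupCohomology`).  HONEST FRAMING: classical Kummer theory at the model;
nothing here bears on [IUTchIII] Cor. 3.12; no side taken.
-/

noncomputable section

/-! ### Generic: restriction / pull / push for the comparison system `J ↦ H¹(J, res_φ Λ(A₂))` -/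

namespace Literature.AnabelianGeometry.EtaleTheta

open groupCohomology CategoryTheory

namespace EquivariantMorphism

variable {G₁ A₁ G₂ A₂ : Type} [Group G₁] [CommGroup A₁] [MulDistribMulAction G₁ A₁]
  [Group G₂] [CommGroup A₂] [MulDistribMulAction G₂ A₂] (c : EquivariantMorphism G₁ A₁ G₂ A₂)

/-- The coefficients `res_φ Λ(A₂)` on a subgroup `J ⊆ G₁` (restriction through `φ| : J → G₂ = ⊤`).
[cite: LANA2026Report, §6.1 p.32] -/
abbrev resRepTop (J : Subgroup G₁) : Rep ℤ J := c.resRep (H₁ := J) (H₂ := ⊤) le_top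

/-- The identity of coefficient modules over an inclusion `J ⊆ H` of subgroups of `G₁`, as a morphism
`(res_φ Λ(A₂))|_H restricted to J ⟶ (res_φ Λ(A₂))|_J`. [cite: LANA2026Report, §6.1 p.32] -/
def resTopHom {H J : Subgroup G₁} (h : J ≤ H) :
    Rep.res (Subgroup.inclusion h) (c.resRepTop H) ⟶ c.resRepTop J :=
  Rep.ofHom
    { toLinearMap := LinearMap.id
      isIntertwining' := fun _ => LinearMap.ext fun _ => rfl }

/-- **Restriction** `H¹(H, res_φ Λ(A₂)) → H¹(J, res_φ Λ(A₂))` for `J ⊆ H ⊆ G₁`.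
[cite: LANA2026Report, §6.1 p.32] -/
abbrev resTop {H J : Subgroup G₁} (h : J ≤ H) : H1 (c.resRepTop H) ⟶ H1 (c.resRepTop J) :=
  groupCohomology.map (Subgroup.inclusion h) (c.resTopHom h) 1

/-- The identity of coefficient modules `(Λ(A₂)|_{J₂}) restricted along φ| ⟶ res_φ Λ(A₂)|_{φ⁻¹J₂}`.
[cite: LANA2026Report, §6.1 p.32] -/
def pullTopHom (J₂ : Subgroup G₂) :
    Rep.res (c.groupHomRestrict (Subgroup.map_comap_le c.groupHom J₂))
        (cyclotomeRep (A := A₂) J₂) ⟶ c.resRepTop (J₂.comap c.groupHom) :=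
  Rep.ofHom
    { toLinearMap := LinearMap.id
      isIntertwining' := fun _ => LinearMap.ext fun _ => rfl }

/-- **Pull-back** `H¹(J₂, Λ(A₂)) → H¹(φ⁻¹J₂, res_φ Λ(A₂))` along `φ| : φ⁻¹J₂ → J₂`.
[cite: LANA2026Report, §6.1 p.32] -/
abbrev pullTop (J₂ : Subgroup G₂) :
    H1 (cyclotomeRep (A := A₂) J₂) ⟶ H1 (c.resRepTop (J₂.comap c.groupHom)) :=
  groupCohomology.map (c.groupHomRestrict (Subgroup.map_comap_le c.groupHom J₂)) (c.pullTopHom J₂) 1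

/-- **Push-forward** `H¹(J₁, Λ(A₁)) → H¹(J₁, res_φ Λ(A₂))` along `Λ(ψ)` (= `pushH1` with `H₂ = ⊤`).
[cite: LANA2026Report, §6.1 p.32] -/
abbrev pushTop (J₁ : Subgroup G₁) : H1 (cyclotomeRep (A := A₁) J₁) ⟶ H1 (c.resRepTop J₁) :=
  c.pushH1 (H₁ := J₁) (H₂ := ⊤) le_top

/-- `resTop` along `J ≤ J` is the identity. [cite: LANA2026Report, §6.1 p.32] -/
theorem resTop_self (J : Subgroup G₁) (x : H1 (c.resRepTop J)) : c.resTop (le_refl J) x = x := by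
  have h : c.resTop (le_refl J) = 𝟙 _ := by
    rw [resTop, ← groupCohomology.map_id]
    refine groupCohomology.map_congr ?_ ?_ 1
    · exact MonoidHom.ext fun _ => rfl
    · rfl
  rw [h]
  rfl

/-- `resTop` is transitive. [cite: LANA2026Report, §6.1 p.32] -/
theorem resTop_trans {H J L : Subgroup G₁} (hJH : J ≤ H) (hLJ : L ≤ J) (x : H1 (c.resRepTop H)) :
    c.resTop hLJ (c.resTop hJH x) = c.resTop (hLJ.trans hJH) x := by
  change (c.resTop hJH ≫ c.resTop hLJ) x = _
  have e : c.resTop hJH ≫ c.resTop hLJ = c.resTop (hLJ.trans hJH) := by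
    rw [resTop, resTop, resTop, ← groupCohomology.map_comp]
    refine groupCohomology.map_congr ?_ ?_ 1
    · exact MonoidHom.ext fun _ => rfl
    · rfl
  rw [e]

/-- Restriction after pull-back = pull-back from the restricted class, at the cochain level both are
`γ ↦ z(φ γ)`: for `J₂' ⊆ J₂`, `res (pullTop_{J₂} [z]) = pullTop_{J₂'} (res [z])`.
[cite: LANA2026Report, §6.1 p.32] -/
theorem resTop_pullTop {J₂ J₂' : Subgroup G₂} (h : J₂' ≤ J₂) (x : H1 (cyclotomeRep (A := A₂) J₂)) :
    c.resTop (Subgroup.comap_mono (f := c.groupHom) h) (c.pullTop J₂ x) = c.pullTop J₂' (resH1 h x) := by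
  induction x using H1_induction_on with
  | h z =>
    rw [resH1, CoMorphism.H1Map, pullTop, pullTop, resTop, H1π_comp_map_apply, H1π_comp_map_apply,
      H1π_comp_map_apply, H1π_comp_map_apply]
    exact congrArg _ (cocycles₁_ext fun γ => rfl)

/-- Restriction after push-forward = push-forward of the restricted class: for `J₁' ⊆ J₁`,
`res (pushTop_{J₁} [z]) = pushTop_{J₁'} (res [z])`. [cite: LANA2026Report, §6.1 p.32] -/
theorem resTop_pushTop {J₁ J₁' : Subgroup G₁} (h : J₁' ≤ J₁) (x : H1 (cyclotomeRep (A := A₁) J₁)) :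
    c.resTop h (c.pushTop J₁ x) = c.pushTop J₁' (resH1 h x) := by
  induction x using H1_induction_on with
  | h z =>
    rw [resH1, CoMorphism.H1Map, pushTop, pushTop, pushH1, pushH1, resTop, H1π_comp_map_apply,
      H1π_comp_map_apply, H1π_comp_map_apply, H1π_comp_map_apply]
    exact congrArg _ (cocycles₁_ext fun γ => rfl)

/-- **Level naturality in the comparison system**: for `J₁ ⊆ φ⁻¹J₂`, a root system `x` of `a ∈ A₁^{J₁}` and
`ψ(a) ∈ A₂^{J₂}`, `res_{J₁ ⊆ φ⁻¹J₂} (pullTop_{J₂} κ_{J₂}(ψ a)) = pushTop_{J₁} κ_{J₁}(a)` (cochain level: both are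
`γ ↦ (ψ((γ • x_n)/x_n))_n`). [cite: LANA2026Report, §6.1 p.32] -/
theorem resTop_pullTop_kummerClassOfRootSystem {J₁ : Subgroup G₁} {J₂ : Subgroup G₂}
    (h : J₁ ≤ J₂.comap c.groupHom) {a : A₁} (x : RootSystem a) (ha : a ∈ MulAction.fixedPoints J₁ A₁)
    (hb : c.map a ∈ MulAction.fixedPoints J₂ A₂) :
    c.resTop h (c.pullTop J₂ (kummerClassOfRootSystem J₂ (x.map c.map) hb)) =
      c.pushTop J₁ (kummerClassOfRootSystem J₁ x ha) := by
  rw [kummerClassOfRootSystem, kummerClassOfRootSystem, pullTop, resTop, pushTop, pushH1,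
    H1π_comp_map_apply, H1π_comp_map_apply, H1π_comp_map_apply]
  congr 1
  refine cocycles₁_ext fun γ => ?_
  rw [coe_mapCocycles₁, coe_mapCocycles₁, coe_mapCocycles₁]
  change Additive.ofMul ((x.map c.map).kummerCocycle hb
      (c.groupHomRestrict (Subgroup.map_comap_le c.groupHom J₂) (Subgroup.inclusion h γ))) =
    (c.cyclotomeHom (H₁ := J₁) (H₂ := ⊤) le_top).hom (kummerCocycles₁ J₁ x ha γ)
  have e : c.groupHomRestrict (Subgroup.map_comap_le c.groupHom J₂) (Subgroup.inclusion h γ) =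
      c.groupHomRestrict (H₁ := J₁) (H₂ := J₂) (fun _ ⟨g, hg, hgx⟩ => hgx ▸ h hg) γ :=
    Subtype.ext rfl
  rw [e, c.kummerCocycle_map _ x ha hb γ]
  rfl

variable [RootableBy A₁ ℕ] [RootableBy A₂ ℕ]

/-- The same with the canonical Kummer classes: for `a ∈ A₁^{J₁}`, `b ∈ A₂^{J₂}`, `ψ a = b`, `J₁ ⊆ φ⁻¹J₂`:
`res (pullTop κ_{J₂}(b)) = pushTop κ_{J₁}(a)`. [cite: LANA2026Report, §6.1 p.32] -/
theorem resTop_pullTop_kummerClass {J₁ : Subgroup G₁} {J₂ : Subgroup G₂} (h : J₁ ≤ J₂.comap c.groupHom)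
    (a : invariants (A := A₁) J₁) (b : invariants (A := A₂) J₂) (hab : c.map a = b) :
    c.resTop h (c.pullTop J₂ (kummerClass J₂ b)) = c.pushTop J₁ (kummerClass J₁ a) := by
  have hb : c.map (a : A₁) ∈ MulAction.fixedPoints J₂ A₂ := by rw [hab]; exact b.2
  have e : kummerClass J₂ b = kummerClassOfRootSystem J₂ ((RootSystem.ofRootableBy (a : A₁)).map c.map) hb := by
    obtain ⟨b, hb'⟩ := b
    cases hab
    exact kummerClass_eq_of_rootSystem J₂ _ _
  rw [e, kummerClass]
  exact c.resTop_pullTop_kummerClassOfRootSystem h _ a.2 hb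

end EquivariantMorphism

end Literature.AnabelianGeometry.EtaleTheta

/-! ### The colimit maps and Prop 3.2 (ii) in colimit form, at the model -/

namespace Literature.AnabelianGeometry.AbsoluteAnabelian

open Literature.AnabelianGeometry.EtaleTheta (kummerClass invariants cyclotomeRep EquivariantMorphism resH1)

section Colimit

variable {C₁ C₂ : MLFClosure.{0}} {D₁ : ModelMLFGaloisData C₁.k C₁.K} {D₂ : ModelMLFGaloisData C₂.k C₂.K}
  (c : EquivariantMorphism D₁.Pi (C₁.K)ˣ D₂.Pi (C₂.K)ˣ) (hc : Continuous c.groupHom)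

namespace ModelMLFGaloisData

/-- **The comparison cohomology data on `Π₁`**: `J ↦ H¹(J, res_φ Λ(k̄₂ˣ))` with its restriction maps (the
`H²`-slot is the placeholder `Ẑ`, exactly as in `kummerCohomology`). [cite: MochizukiAbsTopIII2015, Proposition 3.2 (ii) p.71] -/
def resCohomology : ContCohomologyData D₁.tmPair.Pi where
  H1 J := groupCohomology.H1 (c.resRepTop (J : Subgroup D₁.Pi))
  res h := (c.resTop (OpenSubgroup.toSubgroup_le.mpr h)).hom.toAddMonoidHom
  res_id J := AddMonoidHom.ext fun x => c.resTop_self (J : Subgroup D₁.Pi) x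
  res_comp h₁ h₂ := AddMonoidHom.ext fun x =>
    (c.resTop_trans (OpenSubgroup.toSubgroup_le.mpr h₁) (OpenSubgroup.toSubgroup_le.mpr h₂) x).symm
  H2 := ZhatAdd.{0}

/-- The restriction maps of `resCohomology`, unfolded. [cite: MochizukiAbsTopIII2015, Proposition 3.2 (ii) p.71] -/
theorem resCohomology_res {H J : OpenSubgroup D₁.tmPair.Pi} (h : J ≤ H)
    (x : groupCohomology.H1 (c.resRepTop (H : Subgroup D₁.Pi))) :
    (resCohomology c).res h x = c.resTop (OpenSubgroup.toSubgroup_le.mpr h) x :=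
  rfl

/-- The open subgroup `φ⁻¹(J₂) ⊆ Π₁` (`φ` continuous). [cite: MochizukiAbsTopIII2015, Definition 3.1 (ii) p.67] -/
def comapOpen' (J₂ : OpenSubgroup D₂.tmPair.Pi) : OpenSubgroup D₁.tmPair.Pi :=
  ⟨(J₂ : Subgroup D₂.Pi).comap c.groupHom, J₂.isOpen.preimage hc⟩

/-- The underlying subgroup of `comapOpen'`. [cite: MochizukiAbsTopIII2015, Definition 3.1 (ii) p.67] -/
@[simp] theorem coe_comapOpen' (J₂ : OpenSubgroup D₂.tmPair.Pi) :
    ((comapOpen' c hc J₂ : OpenSubgroup D₁.tmPair.Pi) : Subgroup D₁.Pi) = (J₂ : Subgroup D₂.Pi).comap c.groupHom :=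
  rfl

/-- **The colimit pull-back** `lim→_{J₂} H¹(J₂, Λ(k̄₂ˣ)) →+ lim→_{J₁} H¹(J₁, res_φ Λ(k̄₂ˣ))`: on a class `[x]`
at level `J₂` it is `[pullTop x]` at level `φ⁻¹J₂` (well defined by `resTop_pullTop`).
[cite: MochizukiAbsTopIII2015, Proposition 3.2 (ii) p.71] -/
def pullLim : (D₂.kummerCohomology C₂).H1LimGrp →+ (resCohomology c).H1LimGrp :=
  AddCommGroup.DirectLimit.lift _ _ _
    (fun i => ((resCohomology c).ofGrp (comapOpen' c hc i.J)).comp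
      (c.pullTop (i.J : Subgroup D₂.Pi)).hom.toAddMonoidHom)
    (fun i j hij x => by
      change (resCohomology c).ofGrp (comapOpen' c hc j.J)
          (c.pullTop (j.J : Subgroup D₂.Pi) (resH1 (ContCohomologyData.LimIdx.le_iff.mp hij) x)) =
        (resCohomology c).ofGrp (comapOpen' c hc i.J) (c.pullTop (i.J : Subgroup D₂.Pi) x)
      rw [← c.resTop_pullTop (ContCohomologyData.LimIdx.le_iff.mp hij) x]
      exact (resCohomology c).ofGrp_res (H := comapOpen' c hc i.J) (J := comapOpen' c hc j.J)
        (fun g hg => (ContCohomologyData.LimIdx.le_iff.mp hij) hg) _)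

/-- `pullLim` on a class at level `J₂`. [cite: MochizukiAbsTopIII2015, Proposition 3.2 (ii) p.71] -/
@[simp] theorem pullLim_ofGrp (J₂ : OpenSubgroup D₂.tmPair.Pi)
    (x : groupCohomology.H1 (cyclotomeRep (A := (C₂.K)ˣ) (J₂ : Subgroup D₂.Pi))) :
    pullLim c hc ((D₂.kummerCohomology C₂).ofGrp J₂ x) =
      (resCohomology c).ofGrp (comapOpen' c hc J₂) (c.pullTop (J₂ : Subgroup D₂.Pi) x) :=
  AddCommGroup.DirectLimit.lift_of _ _ _ _ _

/-- **The colimit push-forward** `lim→_{J₁} H¹(J₁, Λ(k̄₁ˣ)) →+ lim→_{J₁} H¹(J₁, res_φ Λ(k̄₂ˣ))`: `[x] ↦ [pushTop x]`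
(well defined by `resTop_pushTop`). [cite: MochizukiAbsTopIII2015, Proposition 3.2 (ii) p.71] -/
def pushLim : (D₁.kummerCohomology C₁).H1LimGrp →+ (resCohomology c).H1LimGrp :=
  AddCommGroup.DirectLimit.lift _ _ _
    (fun i => ((resCohomology c).ofGrp i.J).comp (c.pushTop (i.J : Subgroup D₁.Pi)).hom.toAddMonoidHom)
    (fun i j hij x => by
      change (resCohomology c).ofGrp j.J
          (c.pushTop (j.J : Subgroup D₁.Pi) (resH1 (ContCohomologyData.LimIdx.le_iff.mp hij) x)) =
        (resCohomology c).ofGrp i.J (c.pushTop (i.J : Subgroup D₁.Pi) x)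
      rw [← c.resTop_pushTop (ContCohomologyData.LimIdx.le_iff.mp hij) x]
      exact (resCohomology c).ofGrp_res (ContCohomologyData.LimIdx.le_iff.mp hij) _)

/-- `pushLim` on a class at level `J₁`. [cite: MochizukiAbsTopIII2015, Proposition 3.2 (ii) p.71] -/
@[simp] theorem pushLim_ofGrp (J₁ : OpenSubgroup D₁.tmPair.Pi)
    (x : groupCohomology.H1 (cyclotomeRep (A := (C₁.K)ˣ) (J₁ : Subgroup D₁.Pi))) :
    pushLim c ((D₁.kummerCohomology C₁).ofGrp J₁ x) =
      (resCohomology c).ofGrp J₁ (c.pushTop (J₁ : Subgroup D₁.Pi) x) :=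
  AddCommGroup.DirectLimit.lift_of _ _ _ _ _

/-- **Colimit naturality of Kummer classes (generic over the model cohomology data).**  For open
`J₁ ⊆ Π₁`, `J₂ ⊆ Π₂` and invariant units `a ∈ (k̄₁ˣ)^{J₁}`, `b ∈ (k̄₂ˣ)^{J₂}` with `ψ(a) = b`:
`pullLim [κ_{J₂}(b)] = pushLim [κ_{J₁}(a)]` in `lim→_{J} H¹(J, res_φ Λ(k̄₂ˣ))` — NO relation between `J₁` and
`J₂` is needed (compare at the common level `J₁ ∩ φ⁻¹J₂`).  Serves the `TM` Kummer theory below and the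
`TLG`/`TCG` unit Kummer theories of `UnitKummerModel.lean` (same `kummerCohomology`).
[cite: MochizukiAbsTopIII2015, Proposition 3.2 (ii) p.71] -/
theorem pullLim_kummerClass (J₁ : OpenSubgroup D₁.tmPair.Pi) (J₂ : OpenSubgroup D₂.tmPair.Pi)
    (a : invariants (A := (C₁.K)ˣ) (J₁ : Subgroup D₁.Pi)) (b : invariants (A := (C₂.K)ˣ) (J₂ : Subgroup D₂.Pi))
    (hab : c.map a = b) :
    pullLim c hc ((D₂.kummerCohomology C₂).ofGrp J₂ (kummerClass (J₂ : Subgroup D₂.Pi) b)) =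
      pushLim c ((D₁.kummerCohomology C₁).ofGrp J₁ (kummerClass (J₁ : Subgroup D₁.Pi) a)) := by
  obtain ⟨a₀, ha₀⟩ := a
  rw [pullLim_ofGrp, pushLim_ofGrp, ContCohomologyData.ofGrp_eq_ofGrp_iff]
  let L : OpenSubgroup D₁.tmPair.Pi := J₁ ⊓ comapOpen' c hc J₂
  have hL₂ : (L : Subgroup D₁.Pi) ≤ (J₂ : Subgroup D₂.Pi).comap c.groupHom :=
    OpenSubgroup.toSubgroup_le.mpr (inf_le_right : L ≤ comapOpen' c hc J₂)
  have hL₁ : (L : Subgroup D₁.Pi) ≤ (J₁ : Subgroup D₁.Pi) :=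
    OpenSubgroup.toSubgroup_le.mpr (inf_le_left : L ≤ J₁)
  refine ⟨L, inf_le_right, inf_le_left, ?_⟩
  change c.resTop hL₂ (c.pullTop (J₂ : Subgroup D₂.Pi) (kummerClass (J₂ : Subgroup D₂.Pi) b)) =
    c.resTop hL₁ (c.pushTop (J₁ : Subgroup D₁.Pi) (kummerClass (J₁ : Subgroup D₁.Pi) ⟨a₀, ha₀⟩))
  rw [c.resTop_pushTop, EtaleTheta.resH1_kummerClass hL₁ a₀ ha₀]
  exact c.resTop_pullTop_kummerClass hL₂ ⟨a₀, fun g => ha₀ ⟨g.1, hL₁ g.2⟩⟩ b hab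

end ModelMLFGaloisData

end Colimit

/-! ### Prop 3.2 (ii), colimit form, for the model `TM`-pairs -/

namespace ModelMLFGaloisData

variable {C₁ C₂ : MLFClosure.{0}} {D₁ : ModelMLFGaloisData C₁.k C₁.K} {D₂ : ModelMLFGaloisData C₂.k C₂.K}
  (φP : D₁.Pi →* D₂.Pi) (hφ : Continuous φP) (φM : nonzeroIntegers C₁.k C₁.K →* nonzeroIntegers C₂.k C₂.K)
  (h : ∀ (g : D₁.Pi) (m : nonzeroIntegers C₁.k C₁.K), φM (g • m) = φP g • φM m)

/-- **[AbsTopIII] Prop 3.2 (ii), colimit form, at the MODEL**: for an equivariant pair `(φ_Π, φ_M)` between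
model `TM`-pairs with `φ_Π` continuous and every `m ∈ 𝒪_k̄₁^⊳`, the colimit Kummer classes
`κ^lim(m) ∈ lim→_J H¹(J, Λ(k̄ˣ))` (`MonoidKummerTheory.kummerGrp` of `ModelMLFGaloisData.kummerTheory`) satisfy
`pullLim (κ^lim₂(φ_M m)) = pushLim (κ^lim₁(m))` ("… the Kummer maps … `M_TM → lim→_J H¹(J, μ_Ẑ(M_TM))`",
functorially). [cite: MochizukiAbsTopIII2015, Proposition 3.2 (ii) p.71] -/
theorem kummerGrp_natural (m : nonzeroIntegers C₁.k C₁.K) :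
    pullLim (unitsMorphism φM φP h) hφ ((D₂.kummerTheory C₂).kummerGrp (φM m)) =
      pushLim (unitsMorphism φM φP h) ((D₁.kummerTheory C₁).kummerGrp m) := by
  rw [(D₂.kummerTheory C₂).kummerGrp_eq_ofGrp (φM m) (D₂.tmPair.stabilizerOpen (φM m))
      (fun g => (D₂.tmPair.mem_stabilizerOpen_iff _ _).mp g.2),
    (D₁.kummerTheory C₁).kummerGrp_eq_ofGrp m (D₁.tmPair.stabilizerOpen m)
      (fun g => (D₁.tmPair.mem_stabilizerOpen_iff _ _).mp g.2),
    kummerTheory_kummer, kummerTheory_kummer]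
  exact pullLim_kummerClass (unitsMorphism φM φP h) hφ _ _ (D₁.invariantUnit C₁ _ _)
    (D₂.invariantUnit C₂ _ _) (unitsLift_toUnit φM m)

end ModelMLFGaloisData

namespace GaloisMonoidPair

variable {C₁ C₂ : MLFClosure.{0}} {D₁ : ModelMLFGaloisData C₁.k C₁.K} {D₂ : ModelMLFGaloisData C₂.k C₂.K}

/-- **Prop 3.2 (ii), colimit form, along a morphism of the model `TM`-pairs** (Def. 3.1 (ii)).
[cite: MochizukiAbsTopIII2015, Proposition 3.2 (ii) p.71] -/
theorem Hom.kummerGrp_natural (f : GaloisMonoidPair.Hom D₁.tmPair D₂.tmPair) (m : D₁.tmPair.M) :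
    ModelMLFGaloisData.pullLim f.unitsMorphism f.continuous_homPi ((D₂.kummerTheory C₂).kummerGrp (f.homM m)) =
      ModelMLFGaloisData.pushLim f.unitsMorphism ((D₁.kummerTheory C₁).kummerGrp m) :=
  ModelMLFGaloisData.kummerGrp_natural f.homPi f.continuous_homPi f.homM f.smul_comm m

/-- **Prop 3.2 (ii), colimit form, along an isomorphism of the model `TM`-pairs** (Def. 3.1 (ii)).
[cite: MochizukiAbsTopIII2015, Proposition 3.2 (ii) p.71] -/
theorem Iso.kummerGrp_natural (e : GaloisMonoidPair.Iso D₁.tmPair D₂.tmPair) (m : D₁.tmPair.M) :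
    ModelMLFGaloisData.pullLim e.unitsMorphism e.isoPi.continuous ((D₂.kummerTheory C₂).kummerGrp (e.isoM m)) =
      ModelMLFGaloisData.pushLim e.unitsMorphism ((D₁.kummerTheory C₁).kummerGrp m) :=
  ModelMLFGaloisData.kummerGrp_natural e.isoPi.toMonoidHom e.isoPi.continuous e.isoM.toMonoidHom e.smul_comm m

end GaloisMonoidPair

end Literature.AnabelianGeometry.AbsoluteAnabelian

end
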